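import Literature.MathematicalPhysics.QuantumFieldTheory.Balaban1983to89.B16Ineq382Cases
import Literature.MathematicalPhysics.QuantumFieldTheory.Balaban1983to89.B16Sect1Statements

/-!
# `Balaban1983to89.B16Ineq382TreeGauge` — T. Bałaban, *Large field renormalization. II. Localization, exponentiation, and bounds for the 𝐑 operation*, Commun. Math. Phys. **122** (1989) 355–392 [Balaban1989LargeFieldII], pp. 381–382, case 1 of the factor `1 − χ′`: *"By elementary reasoning, the same as in the proof of Lemma 1 [14], we obtain the estimate |V₁(b) − 1| < 6(100MR_{j−N+1})²ε"* — PROVED at object level for the generalized axial gauge of [Balaban1989LargeFieldI] p. 196 on a rectangular annulus of `ℤ^d` (PART 2b, final; PART 2a = `B16Ineq382Cases`; the row's typed arithmetic shape `B16Sect1Statements.Ineq382V₁` is DISCHARGED BY NAME)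

statement-level skeleton of published theorems with citation tags; proofs where landed; nothing here is a claim about the Yang–Mills mass gap

PDF held: `paper:balaban1989-cmp122-large-field-ii` (journal page = PDF page + 354; pp. 381–382 = PDF pp. 27–28,
re-read AS IMAGES for this file: `run/shared/lean/pub/pub-balaban/b2b-balaban-ref1/pages/1989-cmp122-large-field-II/
…-p027-x2.png`, `…-p028-x2.png`); `paper:balaban1989-cmp122-large-field-i` (pp. 177, 195–196 = PDF pp. 3, 21–22:
condition (i) and the gauge); [14] = [Balaban1985RegularSpaces] Lemma 1 p. 79 (tree: `B8Lemma1NonAbelian`).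

WHAT IS REPRODUCED (mega-formalization `lit-balaban`, HOME `run/shared/lean/pub/lit-balaban/`, Phase-2 seat p26,
generation 2; SKELETON row **B16.Lem@381** (r13; typed p240851 as the arithmetic shape `Ineq382V₁ dev M R′ ε :=
dev < 6(100MR′)²ε` with `dev` abstract), referee ref-5).  P. 381–382 (render re-read): *"In the first case we assume
that b ⊂ Ω″^{~2}_{h+1}∖Ω″_{h+1}, so it is a bond belonging to the last domain P₁∖P₂, in which the axial gauge was fixed,
the gauge defined in Sect. 1 [IV] before the definition (1.82) [IV]. … Assume that the plaquette variables of V″ on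
this domain are small, i.e., |V″(∂p′) − 1| < ε for p′ ⊂ Ω″^{~2}_{h+1}∖Ω″_{h+1}, and transform the field V″ into a field
satisfying the axial gauge conditions. The gauge transformation v … is given by v(x) = V₀(Γ_{y,x}), where the contour
Γ_{y,x} was defined in Sect. 1 [IV]. We obtain the field V₁ = V″^v …, which satisfies … the axial gauge conditions.
By elementary reasoning, the same as in the proof of Lemma 1 [14], we obtain the estimate |V₁(b) − 1| <
6(100MR_{j−N+1})²ε ≦ 6(100M(L+1)N^{β₀}R_j)²ε, where we have taken into account that Ω″ᶜ_{h+1} satisfies the condition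
(i)"* ([IV] p. 177, (i): "it is contained in a cube of the size 100MR_k").

THE THEOREM (over the carriers of `B15TreeGauge196*` / `B16Ineq382Stokes`, `d = n + 3`).  `Case1Hyp lo hi lo' hi' τ W V
ε` = the printed situation: the annulus `P₁ ∖ P₂` of sites (`ann`, geometry `Geom`), every side of `P₁` of at most
`W + 1` sites, `V` a `U1 𝔸`-valued bond field IN THE GAUGE (`V(Γ_{y,x}) = 1` for `x ∈ P₁∖P₂`, the contours of [IV]
p. 196) whose plaquettes with corners in `P₁∖P₂` deviate from `1` by `≤ ε`.  **`norm_bond_sub_one_le`**: every bond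
`b = ⟨x, x + e_μ⟩` with both ends in `P₁∖P₂` has `‖V(b) − 1‖ ≤ (5W² + dW)ε`; **`norm_bond_sub_one_lt`**: `< 6D²ε`
when the sides have at most `D` sites and `d ≤ D`; **`ineq382V₁`**: with `D = 100MR′` this IS
`B16Sect1Statements.Ineq382V₁ ‖V(b) − 1‖ M R′ ε`; **`case1Hyp_gaugeFixed`** / **`ineq382V₁_gaugeFixed`**: for ANY `V″`
with small plaquettes on `P₁∖P₂` the gauge-fixed field `V₁ = V″^v`, `v(x) = V″(Γ_{y,x})`, satisfies the hypotheses,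
hence the printed estimate.  THE PROOF (the surfaces behind "elementary reasoning"): in the gauge, `V(b)` is conjugate
to the holonomy of `Γ_{y,b₋} ∪ b ∪ Γ_{y,b₊}⁻¹` (`B16Ineq382Stokes.bond_eq_conj_loop`); by the pair decompositions of
`B15TreeGauge196` this loop is a THIN STRIP (ladder) of `≤ dW` plaquettes along the two contours (both usual; both
detour; `≤ (n+3)W·ε`), trivial for a bond on the tree, and — for the one bond `⟨(a, x₂, …), (a+1, x₂, …)⟩` crossing the
threshold, where `Γ_{y,b₋}` is usual and `Γ_{y,b₊}` takes the detour — the boundary of the RECTANGLE `[y₁, b₁−1/2] ×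
[y₂, x₂]` in the `(1,2)`-plane: a flat `≤ W²`-plaquette Stokes bound when that rectangle misses `P₂`, and otherwise
(`P₂` inside the rectangle's plane region, `x₂ > b′₂`) the rectangle is first MOVED in the direction `3` down to the
face `x₃ = y₃` of `P₁` (a cylinder of `≤ 4W²` plaquettes avoiding `P₂`, `norm_hol_shift_sub_one_le`) and spanned
there (`≤ W²`): total `≤ 5W²ε`.  All plaquettes used have their corners in `P₁∖P₂` (`contour_pathIn` and the explicit
side computations), i.e. are plaquettes "⊂ Ω″^{~2}_{h+1}∖Ω″_{h+1}".

HONEST SCOPE / DEVIATIONS.  (1) Model: one rectangular annulus `P₁∖P₂ ⊂ ℤ^{n+3}` with `P₂` strictly inside `P₁`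
(margins of the nested sequence, [IV] p. 179) and `a ∈ (a′₁, b′₁)`; `d ≥ 3` is NEEDED (in `d = 2` the annulus is not
simply connected and the estimate fails) — the print has `d = 4`.  (2) `U1 𝔸`-valued fields (`⊇ U(N)`), `≤ ε`
plaquette hypothesis, conclusion `≤ (5W² + dW)ε`, and the printed strict form under `0 < ε`, `d ≤ D`.  (3) The
constant: the print's `6·(side)²` is met with room (`5(D−1)² + d(D−1) < 6D²`); the print gives no derivation of `6`.
(4) Not reproduced: the identification `V″(Γ_{y,x}) = V₀(Γ_{y,x})` ("because V′ satisfies the conditions") — here `v`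
is built from the field being gauge-fixed, which is the same transformation under that identification; the rest of
case 1 (the bounds on `v`, `V′`, `B′`, the choice `ε = (24R_j⁴)⁻¹δ′_j` and the Wilson factor) is r13's
`B16Sect1Statements` §12 arithmetic, untouched.  Every declaration is a definition with a body or a proved theorem;
nothing of [IV]/[V] is asserted as a hypothesis-free fact beyond what is proved.  Unit `lit-balaban-p26`
(literature-prover-lit-balaban-p26-g2-0).
-/

noncomputable section

open scoped BigOperators

namespace Literature.MathematicalPhysics.QuantumFieldTheory.Balaban1983to89.B16Ineq382

open B7Prop1Explicit B8Lemma1NonAbelian B15TreeGauge196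

variable {n : ℕ} {𝔸 : Type*} [NormedRing 𝔸] [NormOneClass 𝔸]
variable {lo hi lo' hi' : Site (n + 3)} {τ : ℤ} {W : ℕ} {V : Site (n + 3) → Fin (n + 3) → 𝔸ˣ} {ε : ℝ}

/-! ## §3 (continued) The bond across the threshold -/

/-- **The mixed pair** (`x₁ = a`'s last site, `b = ⟨x, x + e₁⟩`): `‖V(b) − 1‖ ≤ 5W²ε` — the rectangle of the two
contours, flat if it avoids `P₂`, otherwise moved in direction `3` to the face `x₃ = y₃` of `P₁` and spanned there.
[cite: Balaban1989LargeFieldII, p.382] -/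
theorem case_mixed (H : Case1Hyp lo hi lo' hi' τ W V ε) {x : Site (n + 3)}
    (hx : x ∈ ann lo hi lo' hi') (hx' : x + e i0 ∈ ann lo hi lo' hi') (hxτ : x i0 = τ) :
    ‖((V x i0 : 𝔸ˣ) : 𝔸) - 1‖ ≤ 5 * (W : ℝ) ^ 2 * ε := by
  have hxb := mem_box_iff.mp hx.1
  have hG := H.geom
  -- the natural numbers m = x₂ − y₂, n₀ = x₁ − y₁, k = b₁ − 1/2 − x₁ − 1, N = n₀ + k + 1
  obtain ⟨m, hm⟩ := Int.eq_ofNat_of_zero_le (show 0 ≤ x i1 - lo i1 by linarith [(hxb i1).1])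
  obtain ⟨n₀, hn₀⟩ := Int.eq_ofNat_of_zero_le (show 0 ≤ x i0 - lo i0 by linarith [(hxb i0).1])
  have hle : x i0 + 1 ≤ hi i0 := by simpa [e_apply_self] using (mem_box_iff.mp hx'.1 i0).2
  obtain ⟨k, hk⟩ := Int.eq_ofNat_of_zero_le (show 0 ≤ hi i0 - x i0 - 1 by linarith)
  have hN : hi i0 - lo i0 = ((n₀ + (k + 1) : ℕ) : ℤ) := by push_cast; omega
  obtain ⟨hc, hc'⟩ := contour_pair_mixed (lo := lo) (hi := hi) hxτ
  rw [hm, hn₀] at hc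
  rw [hm, hN, show x i0 + 1 - hi i0 = -(k : ℤ) by omega] at hc'
  set c := tw (highDirs n) (x - lo)
  set u := seg i1 (m : ℤ) ++ seg i0 (n₀ : ℤ)
  set u' := seg i0 ((n₀ + (k + 1) : ℕ) : ℤ) ++ seg i1 (m : ℤ) ++ seg i0 (-(k : ℤ))
  have hp0 : lo + disp c = pt (lo i0) (lo i1) x := by rw [disp_tw highDirs_nodup, add_restrict_highDirs]
  have hg := H.gauge x hx
  rw [hc, hol_append, hp0] at hg
  have hg' := H.gauge _ hx'
  rw [hc', hol_append, hp0] at hg'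
  have hend : disp u' = disp u + e i0 := by
    simp only [u, u', disp_append, disp_seg]
    push_cast
    rw [add_zsmul, add_zsmul, one_zsmul, neg_zsmul]
    abel
  have hxq : pt (lo i0) (lo i1) x + disp u = x := by
    simp only [u, disp_append, disp_seg]
    rw [← add_assoc, pt_add_e1, pt_add_e0, ← hm, ← hn₀, show lo i1 + (x i1 - lo i1) = x i1 by ring,
      show lo i0 + (x i0 - lo i0) = x i0 by ring, pt_self]
  have hb := bond_eq_conj_loop V (hol V lo c) _ u u' i0 hend hg hg'
  rw [hxq, loop_eq_wideLadder] at hb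
  rw [hb, Units.val_mul, Units.val_mul]
  refine (norm_units_conj_sub_one_le (hol_mem H.unit lo c) _).trans ?_
  -- the rectangle `R`: boundary word `w`, at `p = (y₁, y₂, x₃, …)`
  set w := wideLadder (seg i1 (m : ℤ)) i0 (n₀ + (k + 1)) with hw
  have hmW : m ≤ W := by have := H.natAbs_le hx.1 i1; rw [Pi.sub_apply, hm] at this; simpa using this
  have hNW : n₀ + (k + 1) ≤ W := by have := H.width i0; omega
  have hmhi : lo i1 + m ≤ hi i1 := by linarith [(hxb i1).2]
  have hNhi : lo i0 + (n₀ + (k + 1) : ℕ) ≤ hi i0 := by omega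
  have hW2 : (W : ℝ) ^ 2 * ε ≤ 5 * (W : ℝ) ^ 2 * ε := by nlinarith [H.eps_nonneg, sq_nonneg (W : ℝ)]
  by_cases hflat : (∃ κ : Fin (n + 3), 2 ≤ κ.val ∧ (x κ < lo' κ ∨ hi' κ < x κ)) ∨ x i1 < lo' i1 ∨ hi' i0 < lo' i0
  · -- the rectangle avoids `P₂`: flat Stokes
    refine (flat_bound H hmhi hNhi (fun κ _ => hxb κ) (fun s t hs ht => ?_) hmW hNW).trans hW2
    rcases hflat with ⟨κ, hκ, hout⟩ | h1 | h0
    · rcases hout with hout | hout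
      · exact not_mem_box_of_lt κ (by rwa [pt_high _ _ _ hκ])
      · exact not_mem_box_of_gt κ (by rwa [pt_high _ _ _ hκ])
    · exact not_mem_box_of_lt i1 (by rw [pt_i1]; omega)
    · intro hz
      have := (mem_box_iff.mp hz i0).1; have := (mem_box_iff.mp hz i0).2; omega
  · -- `P₂` meets the rectangle's plane region: then `x₂ > b′₂`; move down to the face `x₃ = y₃`
    simp only [not_or, not_exists, not_and, not_lt] at hflat
    obtain ⟨hin, h1, h0⟩ := hflat
    have hin' : ∀ κ : Fin (n + 3), 2 ≤ κ.val → lo' κ ≤ x κ ∧ x κ ≤ hi' κ := fun κ hκ => hin κ hκ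
    obtain ⟨hb0l, hb0r⟩ := hxb i0
    obtain ⟨hb1l, hb1r⟩ := hxb i1
    obtain ⟨hb2l, hb2r⟩ := hxb i2
    have hx1 : hi' i1 < x i1 := by
      by_contra hle1
      have hτ : τ < lo' i0 := by
        by_contra hτ'
        exact hx.2 (mem_box_iff.mpr fun κ => by
          by_cases hκ : 2 ≤ κ.val
          · exact hin' κ hκ
          · rcases Nat.lt_succ_iff.mp (not_le.mp hκ) |>.eq_or_lt with e1 | e0
            · have : κ = i1 := Fin.ext e1
              subst this; exact ⟨h1, not_lt.mp hle1⟩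
            · have : κ = i0 := Fin.ext (by rw [i0_val]; omega)
              subst this; exact ⟨by omega, by rw [hxτ]; exact hG.tau_le⟩)
      refine hx'.2 (mem_box_iff.mpr fun κ => ?_)
      simp only [Pi.add_apply, e_apply]
      by_cases hκ : 2 ≤ κ.val
      · have e0 : κ ≠ i0 := fun h => by rw [h, i0_val] at hκ; omega
        rw [if_neg e0, add_zero]; exact hin' κ hκ
      · rcases Nat.lt_succ_iff.mp (not_le.mp hκ) |>.eq_or_lt with e1 | e0
        · have : κ = i1 := Fin.ext e1
          subst this; rw [if_neg i1_ne_i0, add_zero]; exact ⟨h1, not_lt.mp hle1⟩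
        · have : κ = i0 := Fin.ext (by rw [i0_val]; omega)
          subst this; rw [if_pos rfl]; have := hG.le_tau; constructor <;> omega
    -- `h = x₃ − y₃`; `x₀` = `x` moved to the face `x₃ = y₃`
    obtain ⟨h, hh⟩ := Int.eq_ofNat_of_zero_le (show 0 ≤ x i2 - lo i2 by linarith)
    set x₀ : Site (n + 3) := x - (h : ℤ) • e i2 with hx₀
    have hx₀κ : ∀ κ : Fin (n + 3), x₀ κ = if κ = i2 then lo i2 else x κ := fun κ => by
      simp only [hx₀, Pi.sub_apply, zsmul_e_apply]
      split_ifs with h2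
      · subst h2; omega
      · omega
    have hy₀ : ∀ κ : Fin (n + 3), 2 ≤ κ.val → lo κ ≤ x₀ κ ∧ x₀ κ ≤ hi κ := fun κ hκ => by
      rw [hx₀κ]
      split_ifs with h2
      · subst h2; exact ⟨le_rfl, hb2l.trans hb2r⟩
      · exact hxb κ
    have hesc₀ : ∀ s t : ℕ, s ≤ n₀ + (k + 1) → t ≤ m → pt (lo i0 + s) (lo i1 + t) x₀ ∉ box lo' hi' :=
      fun s t _ _ => not_mem_box_of_lt i2 (by
        rw [pt_high _ _ _ (show 2 ≤ (i2 : Fin (n + 3)).val from le_rfl), hx₀κ, if_pos rfl]; exact hG.lo_lt i2)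
    have hflat0 := flat_bound H hmhi hNhi hy₀ hesc₀ hmW hNW
    have hpx : pt (lo i0) (lo i1) x = pt (lo i0) (lo i1) x₀ + (h : ℤ) • e i2 := by
      rw [pt_add_e_high _ _ _ _ (show 2 ≤ (i2 : Fin (n + 3)).val from le_rfl), hx₀, sub_add_cancel]
    have hwdir : ∀ l ∈ w, l.1 ≠ i2 := fun l hl h2 => by
      rcases fst_eq_of_mem_wideLadder_seg hl with h' | h'
      · exact i2_ne_i1 (h2.symm.trans h')
      · exact i2_ne_i0 (h2.symm.trans h')
    have hwlen : w.length = 2 * (m + (n₀ + (k + 1))) := by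
      simp only [hw, wideLadder, List.length_append, length_seg, length_revWord, Int.natAbs_neg,
        Int.natAbs_natCast]
      omega
    have hpaths : ∀ j : ℕ, j ≤ h → PathIn (ann lo hi lo' hi') (pt (lo i0) (lo i1) x₀ + (j : ℤ) • e i2) w := by
      intro j hj
      rw [pt_add_e_high _ _ _ _ (show 2 ≤ (i2 : Fin (n + 3)).val from le_rfl)]
      refine pathIn_wideLadder_seg fun s t hs ht hst => ?_
      rw [pt_add_e1, pt_add_e0]
      refine ⟨pt_mem_box_iff.mpr ⟨⟨by omega, by omega⟩, ⟨by omega, by omega⟩, fun κ hκ => ?_⟩, ?_⟩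
      · simp only [Pi.add_apply, zsmul_e_apply, hx₀κ κ]
        by_cases hκ2 : κ = i2
        · subst hκ2; rw [if_pos rfl, if_pos rfl]; constructor <;> omega
        · rw [if_neg hκ2, if_neg hκ2, add_zero]; exact hxb κ
      · rcases hst with rfl | rfl | rfl | rfl
        · exact not_mem_box_of_lt i1 (by rw [pt_i1]; have := hG.lo_lt i1; omega)
        · exact not_mem_box_of_gt i1 (by rw [pt_i1]; omega)
        · exact not_mem_box_of_lt i0 (by rw [pt_i0]; have := hG.lo_lt i0; omega)
        · exact not_mem_box_of_gt i0 (by rw [pt_i0]; have := hG.lt_hi i0; push_cast; omega)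
    have hshift := norm_hol_shift_sub_one_le H.unit H.plaq i2 w (disp_wideLadder _ _ _) hwdir h _ hpaths
    rw [hpx]
    refine hshift.trans ?_
    rw [hwlen]
    have hhW : (h : ℝ) ≤ W := by
      have := H.natAbs_le hx.1 i2
      rw [Pi.sub_apply, hh, Int.natAbs_natCast] at this
      exact_mod_cast this
    have hmW' : (m : ℝ) ≤ W := by exact_mod_cast hmW
    have hNW' : ((n₀ + (k + 1) : ℕ) : ℝ) ≤ W := by exact_mod_cast hNW
    have hε := H.eps_nonneg
    push_cast at hNW' ⊢
    have hprod : (h : ℝ) * (2 * ((m : ℝ) + ((n₀ : ℝ) + ((k : ℝ) + 1))) * ε) ≤ W * (2 * ((W : ℝ) + W) * ε) :=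
      mul_le_mul hhW (mul_le_mul_of_nonneg_right (by linarith) hε) (by positivity) (by positivity)
    nlinarith [hprod, hflat0]

/-! ## §4 The estimate of p. 382 -/

/-- **p. 382, case 1, the object-level estimate**: in the axial gauge of [IV] p. 196 on the annulus `P₁ ∖ P₂`, every
bond with both ends in `P₁ ∖ P₂` satisfies `‖V(b) − 1‖ ≤ (5W² + dW)·ε` (`W + 1` = the number of sites of a side of
`P₁`, `d = n + 3`). [cite: Balaban1989LargeFieldII, p.382] -/
theorem norm_bond_sub_one_le (H : Case1Hyp lo hi lo' hi' τ W V ε) {x : Site (n + 3)} {μ : Fin (n + 3)}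
    (hx : x ∈ ann lo hi lo' hi') (hx' : x + e μ ∈ ann lo hi lo' hi') :
    ‖((V x μ : 𝔸ˣ) : 𝔸) - 1‖ ≤ (5 * (W : ℝ) ^ 2 + (n + 3) * W) * ε := by
  have hε := H.eps_nonneg
  have hW : (0 : ℝ) ≤ W := Nat.cast_nonneg W
  have hA : ((n : ℝ) + 3) * W * ε ≤ (5 * (W : ℝ) ^ 2 + (n + 3) * W) * ε := by nlinarith [sq_nonneg (W : ℝ)]
  have hB : 5 * (W : ℝ) ^ 2 * ε ≤ (5 * (W : ℝ) ^ 2 + (n + 3) * W) * ε := by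
    have h0 : (0 : ℝ) ≤ (n + 3) * W * ε := by positivity
    nlinarith
  by_cases hxτ : x i0 ≤ τ
  · by_cases hxτ' : (x + e μ : Site (n + 3)) i0 ≤ τ
    · refine (case_usual H hx hx' hxτ hxτ').trans (le_trans ?_ hA)
      nlinarith
    · have hμ : μ = i0 := by
        by_contra hne
        apply hxτ'
        simpa [e_apply, Ne.symm hne] using hxτ
      subst hμ
      have hxeq : x i0 = τ := by
        simp only [Pi.add_apply, e_apply_self] at hxτ'; omega
      exact (case_mixed H hx hx' hxeq).trans hB
  · by_cases hμ0 : μ = i0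
    · subst hμ0
      rw [case_detour_i0 H hx hx' hxτ, Units.val_one, sub_self, norm_zero]
      nlinarith
    · by_cases hμ1 : μ = i1
      · subst hμ1
        refine (case_detour_i1 H hx hx' hxτ).trans (le_trans ?_ hA)
        nlinarith
      · have hμ2 : 2 ≤ μ.val := by
          have e0 : μ.val ≠ 0 := fun h => hμ0 (Fin.ext (by rw [h, i0_val]))
          have e1 : μ.val ≠ 1 := fun h => hμ1 (Fin.ext (by rw [h, i1_val]))
          omega
        exact (case_detour_high H hμ2 hx hx' hxτ).trans hA

/-- **p. 382, printed form**: *"|V₁(b) − 1| < 6(100MR_{j−N+1})²ε"* — with `D` the number of sites of a side of the cube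
containing `P₁` (condition (i) of [IV]: "contained in a cube of the size 100MR_k") and `d ≤ D`, every bond of the
annulus has `‖V(b) − 1‖ < 6D²ε`. [cite: Balaban1989LargeFieldII, p.382] -/
theorem norm_bond_sub_one_lt (H : Case1Hyp lo hi lo' hi' τ W V ε) {D : ℕ} (hD : W + 1 ≤ D) (hd : n + 3 ≤ D)
    (hε : 0 < ε) {x : Site (n + 3)} {μ : Fin (n + 3)} (hx : x ∈ ann lo hi lo' hi')
    (hx' : x + e μ ∈ ann lo hi lo' hi') : ‖((V x μ : 𝔸ˣ) : 𝔸) - 1‖ < 6 * (D : ℝ) ^ 2 * ε := by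
  refine (norm_bond_sub_one_le H hx hx').trans_lt (mul_lt_mul_of_pos_right ?_ hε)
  have hD' : (W : ℝ) + 1 ≤ D := by exact_mod_cast hD
  have hd' : (n : ℝ) + 3 ≤ D := by exact_mod_cast hd
  have hW : (0 : ℝ) ≤ W := Nat.cast_nonneg W
  have hn : (0 : ℝ) ≤ n := Nat.cast_nonneg n
  have h1 : ((W : ℝ) + 1) * ((W : ℝ) + 1) ≤ (D : ℝ) * D := mul_le_mul hD' hD' (by positivity) (by positivity)
  have h2 : ((n : ℝ) + 3) * ((W : ℝ) + 1) ≤ (D : ℝ) * D := mul_le_mul hd' hD' (by positivity) (by positivity)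
  nlinarith [h1, h2]

/-- **The row's typed shape, discharged by name**: with `D = 100·M·R′` sites per side, the estimate IS
`B16Sect1Statements.Ineq382V₁ ‖V(b) − 1‖ M R′ ε` (= `‖V(b) − 1‖ < 6(100MR′)²ε`). [cite: Balaban1989LargeFieldII, p.382] -/
theorem ineq382V₁ (H : Case1Hyp lo hi lo' hi' τ W V ε) {M R' : ℕ} (hD : W + 1 ≤ 100 * M * R')
    (hd : n + 3 ≤ 100 * M * R') (hε : 0 < ε) {x : Site (n + 3)} {μ : Fin (n + 3)}
    (hx : x ∈ ann lo hi lo' hi') (hx' : x + e μ ∈ ann lo hi lo' hi') :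
    B16Sect1Statements.Ineq382V₁ ‖((V x μ : 𝔸ˣ) : 𝔸) - 1‖ M R' ε := by
  have h := norm_bond_sub_one_lt H hD hd hε hx hx'
  unfold B16Sect1Statements.Ineq382V₁
  push_cast at h
  exact h

/-! ## §5 Gauge fixing an arbitrary field (p. 381: `V₁ = V″^v`, `v(x) = V″(Γ_{y,x})`) -/

/-- **The printed situation produces the hypotheses**: for ANY `U1`-valued `V″` whose plaquettes with corners in
`P₁ ∖ P₂` are `ε`-small, the gauge-fixed field `V₁ = V″^v`, `v(x) = V″(Γ_{y,x})` (p. 381), satisfies `Case1Hyp` (its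
plaquettes are conjugates of those of `V″`, and `V₁(Γ_{y,x}) = 1`). [cite: Balaban1989LargeFieldII, p.381] -/
theorem case1Hyp_gaugeFixed (hG : Geom lo hi lo' hi' τ) (hW : ∀ κ, hi κ - lo κ ≤ W)
    {V'' : Site (n + 3) → Fin (n + 3) → 𝔸ˣ} (hV : ∀ x κ, V'' x κ ∈ U1 𝔸) (hε : 0 ≤ ε)
    (hP : PlaqSmallOn (ann lo hi lo' hi') V'' ε) :
    Case1Hyp lo hi lo' hi' τ W (gaugeAct (treeGaugeFn V'' lo hi τ) V'') ε where
  geom := hG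
  width := hW
  unit := gaugeAct_mem hV fun _ => hol_mem hV _ _
  eps_nonneg := hε
  plaq := hP.gaugeAct fun _ => hol_mem hV _ _
  gauge := fun x _ => hol_treeGauge_contour V'' hG.lo_le_tau x

/-- **p. 381–382, case 1, as printed**: *"Assume that … |V″(∂p′) − 1| < ε for p′ ⊂ Ω″^{~2}_{h+1}∖Ω″_{h+1}, and transform
the field V″ into a field satisfying the axial gauge conditions … V₁ = V″^v … we obtain the estimate |V₁(b) − 1| <
6(100MR_{j−N+1})²ε"* — for every bond `b` with both ends in the annulus. [cite: Balaban1989LargeFieldII, p.382] -/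
theorem ineq382V₁_gaugeFixed (hG : Geom lo hi lo' hi' τ) {M R' : ℕ} (hD : ∀ κ, hi κ - lo κ + 1 ≤ (100 * M * R' : ℕ))
    (hd : n + 3 ≤ 100 * M * R') {V'' : Site (n + 3) → Fin (n + 3) → 𝔸ˣ} (hV : ∀ x κ, V'' x κ ∈ U1 𝔸)
    (hε : 0 < ε) (hP : PlaqSmallOn (ann lo hi lo' hi') V'' ε) {x : Site (n + 3)} {μ : Fin (n + 3)}
    (hx : x ∈ ann lo hi lo' hi') (hx' : x + e μ ∈ ann lo hi lo' hi') :
    B16Sect1Statements.Ineq382V₁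
      ‖((gaugeAct (treeGaugeFn V'' lo hi τ) V'' x μ : 𝔸ˣ) : 𝔸) - 1‖ M R' ε := by
  have hpos : 1 ≤ 100 * M * R' := le_trans (by omega) hd
  refine ineq382V₁ (W := 100 * M * R' - 1)
    (case1Hyp_gaugeFixed hG (fun κ => ?_) hV hε.le hP) (by omega) hd hε hx hx'
  have := hD κ; omega

end Literature.MathematicalPhysics.QuantumFieldTheory.Balaban1983to89.B16Ineq382
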